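import Summits.PneNP.PneNP.Theorems.SymmetryBudgetHamCompilesFDag

/-!
# The F-side gate DAG of the line `kotzig-cutspan` — part 2: semantics, symmetry action,
# acyclicity measure, proof obligations (crux `SymmetryBudget.HamCompiles`, stmt-PneNP-10637)

Continuation of `SymmetryBudgetHamCompilesFDag.lean` (same namespace `…HamCompilesKC.SymF`):
§3 the intended semantics `fsem` of every gate label as explicit mathematics (subspaces of the span
recursion, their reduced echelon tables, the vectors inserted by the chains, the remainders of the
insertion blocks); §4 the relabelling action `fmapB` of a budget permutation on gate labels; §5 the
acyclicity measure `fμ`; §6 the proof obligations `WireVals`, `BlockEqs`, `StructEqs`, `AutProps`,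
`OutProps` — the registered stubs `stub_symmetricF_wires/blocks/struct/aut/out` of the line are
`theorem … : <obligation>` and the lead assembles `stub_symmetricF` from them
(`GateDAG.compile`, `SymA.eq_rsem`-style uniqueness of the semantics, `isSymmetricUnder_compile_iff`).
-/

-- `Summit.PneNP.PneNP.…` duplicates `PneNP` BY DESIGN (single-problem summit, D-0017).
set_option linter.dupNamespace false

noncomputable section

namespace Summit.PneNP.PneNP.Theorems.HamCompilesKC

open Literature.Computability.Complexity
open Finset

namespace SymF

variable {m : ℕ}

/-! ### §3 The intended semantics of every gate (explicit mathematics) -/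

section Sem

variable (m) (x : Fin m × Fin m → Bool)

/-- Truth value of a `ZMod 2` scalar. -/
def tb (a : ZMod 2) : Bool := decide (a = 1)

/-- Guarding a subspace by a proposition. -/
def gsub (p : Prop) [Decidable p] (U : Submodule (ZMod 2) (Vec (gOf m))) :
    Submodule (ZMod 2) (Vec (gOf m)) := if p then U else ⊥

/-- Closed state: `Cspan` at the decoded margins. -/
def CS (P : PSet m) (e : Cd m) : Submodule (ZMod 2) (Vec (gOf m)) := Cspan m x P.1 (dOf e)

/-- Open state: `Ospan` at the decoded margins. -/
def OS (P : PSet m) (t : Fin m) (i : Fin (gOf m)) (e : Cd m) : Submodule (ZMod 2) (Vec (gOf m)) :=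
  Ospan m x P.1 t i (dOf e)

open scoped Classical in
/-- The base of a tower: `[rk t = i]·C(P∖t, e)` for an open tower, `⊥` for a closed one. -/
def baseSub : TCtx m → Submodule (ZMod 2) (Vec (gOf m))
  | .ot P t i e => gsub m (rk m x t = (i : ℕ) ∧ t ∈ P.1) (CS m x (P.erase t) e)
  | .ct _ _ => ⊥

open scoped Classical in
/-- The `r`-th inner term `[rk t = j ∧ δᵢ+δⱼ ≤ dOf e]·mask_{ij} O(P, t, i, e−δᵢ−δⱼ)`. -/
def innerTerm (P : PSet m) (e : Cd m) (t : Fin m) (r : Fin (gOf m * gOf m)) :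
    Submodule (ZMod 2) (Vec (gOf m)) :=
  gsub m (rk m x t = ((pr r).2 : ℕ) ∧ MGuard e (pr r).1 (pr r).2)
    (maskSub (pr r).1 (pr r).2 (OS m x P t (pr r).1 (cminus e (pr r).1 (pr r).2)))

/-- The inner accumulator `Acc_r = ⨆_{r' < r} innerTerm r'`. -/
def IS (P : PSet m) (e : Cd m) (t : Fin m) (r : ℕ) : Submodule (ZMod 2) (Vec (gOf m)) :=
  ⨆ r' : Fin (gOf m * gOf m), ⨆ (_ : (r' : ℕ) < r), innerTerm m x P e t r'

open scoped Classical in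
/-- The term of a tower member: `[w ∼ t]·O(P∖t, w, i, e)` (open), `Inner(P, e, t)` (closed). -/
def termSub : TCtx m → Fin m → Submodule (ZMod 2) (Vec (gOf m))
  | .ot P t i e, w => gsub m ((Gr m x).Adj w t ∧ t ∈ P.1) (OS m x (P.erase t) w i e)
  | .ct P e, t => IS m x P e t (gOf m * gOf m)

/-- The tower partial sum `U_B = base ⊔ ⨆_{w ∈ B} term w`. -/
def TS (τ : TCtx m) (B : PSet m) : Submodule (ZMod 2) (Vec (gOf m)) :=
  baseSub m x τ ⊔ ⨆ w ∈ B.1, termSub m x τ w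

open scoped Classical in
/-- The left subspace of a chain (`⊥` for the junk chains `w ∉ B`, whose left wire is zero). -/
def leftSub : ChCtx m → Submodule (ZMod 2) (Vec (gOf m))
  | .tw τ B w => if w ∈ B.1 then TS m x τ (B.erase w) else ⊥
  | .inner P e t r => IS m x P e t r

open scoped Classical in
/-- The `k`-th vector inserted by chain `χ` (the row source read as a vector). -/
def yvec : ChCtx m → Fin (N m) → Vec (gOf m)
  | .tw (.ot P t i e) _ w, k =>
      if (Gr m x).Adj w t ∧ t ∈ P.1 then rrefRow (OS m x (P.erase t) w i e) (kc k) else 0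
  | .tw (.ct P e) _ t, k => rrefRow (IS m x P e t (gOf m * gOf m)) (kc k)
  | .inner P e t r, k => fun c' =>
      if c' (pr r).1 = c' (pr r).2 ∧ MGuard e (pr r).1 (pr r).2 ∧ rk m x t = ((pr r).2 : ℕ) then
        rrefRow (OS m x P t (pr r).1 (cminus e (pr r).1 (pr r).2)) (kc k) c'
      else 0

/-- The subspace after `k` insertions: `CH χ k = left ⊔ span {y_0, …, y_{k-1}}`. -/
def CH (χ : ChCtx m) (k : ℕ) : Submodule (ZMod 2) (Vec (gOf m)) :=
  leftSub m x χ ⊔ Submodule.span (ZMod 2) {v | ∃ k' : Fin (N m), (k' : ℕ) < k ∧ v = yvec m x χ k'}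

/-- The table read by block `(χ, k)`. -/
def tabSem (χ : ChCtx m) (k : Fin (N m)) : K m → Vec (gOf m) := rrefRow (CH m x χ k)

/-- The partial remainder `z^{(s)} = y + ∑_{s' < s} y_{c_{s'}} • T[c_{s'}]`. -/
def zs (χ : ChCtx m) (k : Fin (N m)) (s : ℕ) : Vec (gOf m) :=
  yvec m x χ k + ∑ s' : Fin (N m), if (s' : ℕ) < s then
    yvec m x χ k (kc s') • tabSem m x χ k (kc s') else 0

/-- The full remainder `z = reduceBy T y`. -/
def zfin (χ : ChCtx m) (k : Fin (N m)) : Vec (gOf m) := reduceBy (tabSem m x χ k) (yvec m x χ k)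

open scoped Classical in
/-- **Semantics of the block gates.** -/
def bsem (χ : ChCtx m) (k : Fin (N m)) : BK m → Bool
  | .ya s c' => tb (yvec m x χ k (kc s) * tabSem m x χ k (kc s) c')
  | .xo s c' => tb (zs m x χ k s c') || tb (yvec m x χ k (kc s) * tabSem m x χ k (kc s) c')
  | .xa s c' => tb (zs m x χ k s c') && tb (yvec m x χ k (kc s) * tabSem m x χ k (kc s) c')
  | .xn s c' => !(tb (zs m x χ k s c') && tb (yvec m x χ k (kc s) * tabSem m x χ k (kc s) c'))
  | .xr s c' => tb (zs m x χ k ((s : ℕ) + 1) c')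
  | .nz c => !tb (zfin m x χ k c)
  | .ld c => decide (zfin m x χ k ≠ 0 ∧ lead (zfin m x χ k) = c)
  | .al c ℓ => decide (zfin m x χ k ≠ 0 ∧ lead (zfin m x χ k) = ℓ) && tb (tabSem m x χ k c ℓ)
  | .q c => decide (zfin m x χ k ≠ 0) && tb (tabSem m x χ k c (lead (zfin m x χ k)))
  | .nl c => !decide (zfin m x χ k ≠ 0 ∧ lead (zfin m x χ k) = c)
  | .t1 c c' => decide (zfin m x χ k ≠ 0 ∧ lead (zfin m x χ k) = c) && tb (zfin m x χ k c')
  | .wq c c' => tb (zfin m x χ k c') &&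
      (decide (zfin m x χ k ≠ 0) && tb (tabSem m x χ k c (lead (zfin m x χ k))))
  | .uo c c' => tb (tabSem m x χ k c c') || (tb (zfin m x χ k c') &&
      (decide (zfin m x χ k ≠ 0) && tb (tabSem m x χ k c (lead (zfin m x χ k)))))
  | .ua c c' => tb (tabSem m x χ k c c') && (tb (zfin m x χ k c') &&
      (decide (zfin m x χ k ≠ 0) && tb (tabSem m x χ k c (lead (zfin m x χ k)))))
  | .un c c' => !(tb (tabSem m x χ k c c') && (tb (zfin m x χ k c') &&
      (decide (zfin m x χ k ≠ 0) && tb (tabSem m x χ k c (lead (zfin m x χ k))))))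
  | .ux c c' => xor (tb (tabSem m x χ k c c')) (tb (zfin m x χ k c') &&
      (decide (zfin m x χ k ≠ 0) && tb (tabSem m x χ k c (lead (zfin m x χ k)))))
  | .t2 c c' => !decide (zfin m x χ k ≠ 0 ∧ lead (zfin m x χ k) = c) &&
      xor (tb (tabSem m x χ k c c')) (tb (zfin m x χ k c') &&
        (decide (zfin m x χ k ≠ 0) && tb (tabSem m x χ k c (lead (zfin m x χ k)))))
  | .out c c' => tb (rrefRow (CH m x χ ((k : ℕ) + 1)) c c')

open scoped Classical in
/-- **Semantics of the F-side gates.** -/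
def gsem : FG m → Bool
  | .zero => false
  | .one => true
  | .unitC e c _ => decide (dOf e = 0) && decide (c = cmin)
  | .ob P t i e c c' => tb (rrefRow (baseSub m x (.ot P t i e)) c c')
  | .tw τ B c c' => if B.1 = ∅ then false else tb (rrefRow (TS m x τ B) c c')
  | .rowO P t i e w k c' =>
      decide ((Gr m x).Adj w t ∧ t ∈ P.1) && tb (rrefRow (OS m x (P.erase t) w i e) (kc k) c')
  | .rowI P e t r k c' => decide (rk m x t = ((pr r).2 : ℕ)) &&
      tb (rrefRow (OS m x P t (pr r).1 (cminus e (pr r).1 (pr r).2)) (kc k) c')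
  | .blk χ k κ => bsem m x χ k κ

/-- **Semantics of all gates** (the gadget's `rsem` on the gadget). -/
def fsem : FΛ m → Bool
  | .inl l => SymA.rsem m x l
  | .inr f => gsem m x f

/-- Semantics of a wire. -/
def wsem (w : FW m) : Bool := Sum.elim x (fsem m x) w

end Sem

/-! ### §4 The action of a vertex permutation on gate labels -/

section Action

variable (f : Fin m → Fin m) (hf : Function.Injective f)

/-- Image of a subset of the free part under an injective map preserving the free part. -/
def pmap (hF : ∀ u ∈ freeSet m, f u ∈ freeSet m) (P : PSet m) : PSet m :=
  ⟨P.1.map ⟨f, hf⟩, fun u hu => by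
    obtain ⟨v, hv, rfl⟩ := Finset.mem_map.1 hu
    exact hF v (P.2 hv)⟩

variable (hF : ∀ u ∈ freeSet m, f u ∈ freeSet m)

/-- Relabelling of tower contexts. -/
def tmap : TCtx m → TCtx m
  | .ot P t i e => .ot (pmap f hf hF P) (f t) i e
  | .ct P e => .ct (pmap f hf hF P) e

/-- Relabelling of chain contexts. -/
def cmap : ChCtx m → ChCtx m
  | .tw τ B w => .tw (tmap f hf hF τ) (pmap f hf hF B) (f w)
  | .inner P e t r => .inner (pmap f hf hF P) e (f t) r

/-- Relabelling of F-side gate labels (block kinds carry no vertex). -/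
def gmap : FG m → FG m
  | .zero => .zero
  | .one => .one
  | .unitC e c c' => .unitC e c c'
  | .ob P t i e c c' => .ob (pmap f hf hF P) (f t) i e c c'
  | .tw τ B c c' => .tw (tmap f hf hF τ) (pmap f hf hF B) c c'
  | .rowO P t i e w k c' => .rowO (pmap f hf hF P) (f t) i e (f w) k c'
  | .rowI P e t r k c' => .rowI (pmap f hf hF P) e (f t) r k c'
  | .blk χ k κ => .blk (cmap f hf hF χ) k κ

end Action

/-- A budget permutation maps the free part to itself. -/
theorem bud_mem_freeSet {ρ : Equiv.Perm (Fin m)} (hρ : ρ ∈ Bud m (gOf m)) :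
    ∀ u ∈ freeSet m, ρ u ∈ freeSet m := by
  intro u hu
  simp only [freeSet, Finset.mem_filter, Finset.mem_univ, true_and] at hu ⊢
  intro hanch
  have hfix : ρ (ρ u) = ρ u := hρ (ρ u) hanch
  exact hu (by rw [ρ.injective hfix] at hanch; exact hanch)

/-- The relabelling of all gate labels by a budget permutation `ρ` (gadget labels by `SymA.rθ`). -/
def fmapB {ρ : Equiv.Perm (Fin m)} (hρ : ρ ∈ Bud m (gOf m)) : FΛ m → FΛ m :=
  Sum.map (SymA.rθ ρ) (gmap ρ ρ.injective (bud_mem_freeSet hρ))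

/-! ### §5 The acyclicity measure -/

/-- Internal stage of a block gate (strictly increasing along the wiring inside a block). -/
def bstage (m : ℕ) : BK m → ℕ
  | .ya _ _ => 1
  | .xo s _ => 4 * (s : ℕ) + 2
  | .xa s _ => 4 * (s : ℕ) + 2
  | .xn s _ => 4 * (s : ℕ) + 3
  | .xr s _ => 4 * (s : ℕ) + 4
  | .nz _ => 4 * N m + 1
  | .ld _ => 4 * N m + 2
  | .al _ _ => 4 * N m + 3
  | .q _ => 4 * N m + 4
  | .nl _ => 4 * N m + 3
  | .t1 _ _ => 4 * N m + 3
  | .wq _ _ => 4 * N m + 5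
  | .uo _ _ => 4 * N m + 6
  | .ua _ _ => 4 * N m + 6
  | .un _ _ => 4 * N m + 7
  | .ux _ _ => 4 * N m + 8
  | .t2 _ _ => 4 * N m + 9
  | .out _ _ => 4 * N m + 10

/-- DP stage of a tower context: open states of `P` at `2|P| + 2`, closed at `2|P| + 3`. -/
def tstage : TCtx m → ℕ
  | .ot P _ _ _ => 2 * P.1.card + 2
  | .ct P _ => 2 * P.1.card + 3

/-- The acyclicity measure `(DP stage, zone, tower/inner position, block, internal stage)` in the
lexicographic order: every wire of a gate comes from a gate of strictly smaller measure. -/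
def fμ : FΛ m → ℕ ×ₗ ℕ ×ₗ ℕ ×ₗ ℕ ×ₗ ℕ
  | .inl l => toLex (0, toLex (0, toLex (0, toLex (0, SymA.rlayer l))))
  | .inr .zero => toLex (0, toLex (0, toLex (0, toLex (0, 0))))
  | .inr .one => toLex (0, toLex (0, toLex (0, toLex (0, 0))))
  | .inr (.unitC _ _ _) => toLex (0, toLex (0, toLex (0, toLex (0, 0))))
  | .inr (.ob P t i e _ _) => toLex (tstage (.ot P t i e), toLex (1, toLex (1, toLex (0, 0))))
  | .inr (.tw τ B _ _) => toLex (tstage τ, toLex (1, toLex (2 * B.1.card + 1, toLex (0, 0))))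
  | .inr (.rowO P t i e _ k _) =>
      toLex (tstage (.ot P t i e), toLex (1, toLex (0, toLex ((k : ℕ), 0))))
  | .inr (.rowI P e _ r k _) => toLex (tstage (.ct P e), toLex (0, toLex ((r : ℕ), toLex ((k : ℕ), 0))))
  | .inr (.blk (.tw τ B _) k κ) =>
      toLex (tstage τ, toLex (1, toLex (2 * B.1.card, toLex ((k : ℕ), bstage m κ))))
  | .inr (.blk (.inner P e _ r) k κ) =>
      toLex (tstage (.ct P e), toLex (0, toLex ((r : ℕ), toLex ((k : ℕ), bstage m κ))))

/-! ### §6 The proof obligations (registered stubs are `theorem … : <one of these>`) -/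

section Obligations

variable (m) (x : Fin m × Fin m → Bool)

/-- The term a chain adds to its left subspace: the tower term of `w` (for ALL `w`; the junk chains
`w ∉ B` have left subspace `⊥`), resp. the `r`-th inner term. -/
def chainTerm : ChCtx m → Submodule (ZMod 2) (Vec (gOf m))
  | .tw τ _ w => termSub m x τ w
  | .inner P e t r => innerTerm m x P e t r

/-- **Wire values** (obligation `stub_symmetricF_wires`): the table wires of the states carry the
reduced echelon tables of `Ospan`/`Cspan` (the DP identities `Ospan_eq`, `Cspan_eq`), the
accumulator / left / table / row / remainder wires carry their intended vectors, and the vectors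
inserted by a chain span exactly its term (rows of a reduced table span the subspace; masks and
guards are linear). -/
def WireVals : Prop :=
  (∀ (P : PSet m) (t : Fin m) (i : Fin (gOf m)) (e : Cd m) (c c' : K m),
      wsem m x (oTab P t i e c c') = tb (rrefRow (OS m x P t i e) c c')) ∧
  (∀ (P : PSet m) (e : Cd m) (c c' : K m),
      wsem m x (cTab P e c c') = tb (rrefRow (CS m x P e) c c')) ∧
  (∀ (P : PSet m) (e : Cd m) (t : Fin m) (r : ℕ) (c c' : K m), r ≤ gOf m * gOf m →
      wsem m x (accW P e t r c c') = tb (rrefRow (IS m x P e t r) c c')) ∧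
  (∀ (χ : ChCtx m) (c c' : K m), wsem m x (leftW χ c c') = tb (rrefRow (leftSub m x χ) c c')) ∧
  (∀ (χ : ChCtx m) (k : Fin (N m)) (c c' : K m),
      wsem m x (tabW χ k c c') = tb (tabSem m x χ k c c')) ∧
  (∀ (χ : ChCtx m) (k : Fin (N m)) (c' : K m), wsem m x (rowW χ k c') = tb (yvec m x χ k c')) ∧
  (∀ (χ : ChCtx m) (k : Fin (N m)) (s : ℕ) (c' : K m), s ≤ N m →
      wsem m x (zW χ k s c') = tb (zs m x χ k s c')) ∧
  (∀ χ : ChCtx m, Submodule.span (ZMod 2) (Set.range (yvec m x χ)) = chainTerm m x χ) ∧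
  (∀ χ : ChCtx m, CH m x χ (N m) = leftSub m x χ ⊔ chainTerm m x χ)

/-- **Block gate equations** (obligation `stub_symmetricF_blocks`, from `WireVals`): every gate
of every insertion block computes its intended bit from its wires — the Boolean form of
`insertRow` (`stub_rref`, clause 2) for the `out` gates. -/
def BlockEqs : Prop :=
  ∀ (χ : ChCtx m) (k : Fin (N m)) (κ : BK m),
    fsem m x (Sum.inr (FG.blk χ k κ)) = (bfn m κ).2 fun a => wsem m x (bargs χ k κ a)

/-- **Structural gate equations** (obligation `stub_symmetricF_struct`, from `WireVals`): the
gadget gates (`SymA.rsem_eq`), the constants, the hard-wired `C(∅, e)`, the tower bases, the tower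
`∨`-nodes (all `|B|` copies equal: `TS τ (B∖w) ⊔ term w = TS τ B`), and the guarded row sources. -/
def StructEqs : Prop :=
  ∀ l : FΛ m, (match l with
    | Sum.inr (FG.blk _ _ _) => True
    | _ => fsem m x l = (ffn m l).2 fun a => wsem m x (fargs l a))

end Obligations

/-- **Acyclicity and automorphisms** (obligation `stub_symmetricF_aut`): the wiring is well
founded (measure `fμ`), and every budget permutation `ρ`, acting on gate labels by `fmapB`, is an
automorphism: bijective, fixing every output wire, preserving gate functions, and carrying argument
lists to argument lists up to permutation (the clauses of `GateDAG.IsAut`). -/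
def AutProps (m : ℕ) : Prop :=
  (WellFounded fun l' l : FΛ m => ∃ a, fargs l a = Sum.inr l') ∧
  ∀ (ρ : Equiv.Perm (Fin m)) (hρ : ρ ∈ Bud m (gOf m)),
    Function.Bijective (fmapB hρ) ∧
    (∀ i : FIdx m, (fout m i).map (SymA.diag ρ) (fmapB hρ) = fout m i) ∧
    (∀ l : FΛ m, ffn m (fmapB hρ l) = ffn m l) ∧
    ∀ l : FΛ m, (List.ofFn (fargs (fmapB hρ l))).Perm
      ((List.ofFn (fargs l)).map (Sum.map (SymA.diag ρ) (fmapB hρ)))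

/-- **Size and decoding** (obligation `stub_symmetricF_out`): polynomially many gate labels, and the
F-interface bit at `(e, S, S')` is the echelon bit of `Cspan F (dOf e)` at a code word. -/
def OutProps : Prop :=
  (∃ q : Polynomial ℕ, ∀ m : ℕ, Fintype.card (FΛ m) ≤ q.eval m) ∧
  ∀ (m : ℕ) (x : Fin m × Fin m → Bool) (i : FIdx m), fData m x i =
    by classical exact (decide (Valid i.1) && tb (rrefRow (Cspan m x (freeSet m) (dOf i.1)) i.2.1 i.2.2))

end SymF

end Summit.PneNP.PneNP.Theorems.HamCompilesKC
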